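import Literature.NumberTheory.GaloisRepresentations.LubinTateComparisonGroupLaw
import Literature.NumberTheory.GaloisRepresentations.LubinTateSeriesIndependence
import HarnessLib

/-!
# `ϑ(x [+]_f y) = ϑ(x) [+]_{f'} ϑ(y)` on points: the comparison series is additive on `𝔪`

Topic `NumberTheory/GaloisRepresentations`; namespace
`Literature.NumberTheory.GaloisRepresentations.LubinTate`.

The series identity `ϑ(F_f(X₀, X₁)) = F_{f'}(ϑ(X₀), ϑ(X₁))` (`subst_ltF_compSeries`, file
`LubinTateComparisonGroupLaw.lean`; Lubin–Tate 1965 (17)) evaluated at points of a closed nil ideal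
`M` of a complete linearly topologised `A`-algebra (`LubinTatePoints.lean`: `evalPt`, `evalPt₁`,
`evalPt_subst`; `evalPt₁_zero` of `LubinTateSeriesIndependence.lean`): **`evalPt₁_compSeries_ltAdd`** — for `x, y ∈ M`,
`ϑ(F_f(x, y)) = F_{f'}(ϑ(x), ϑ(y))` (the group laws over `𝒪` read in `A` through `ι`).
This is de Shalit's use of `θ : Ĝ_m ≃ F_f` on torsion points (I.3.2 (5): `ω_n = θ^{φ^{-n}}(ζ_n − 1)`;
I.3.3 (7)/(7′): `θ(S) [+] ω ↔ ς(1+S) − 1`). No named facts, no definitions, no `sorry`.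

## References

* [LubinTate1965] J. Lubin, J. Tate, *Formal complex multiplication in local fields*, Ann. of Math. 81
  (1965), Lemma p. 385–386, (17).
* [deShalit1987] E. de Shalit, *Iwasawa theory of elliptic curves with complex multiplication* (1987),
  I.3.2 (3)–(5), I.3.3 (7)–(7′) (p. 17).
-/

noncomputable section

open MvPowerSeries

namespace Literature.NumberTheory.GaloisRepresentations

namespace LubinTate

section GroupLawPoints

variable {A : Type*} [CommRing A] [UniformSpace A] [DiscreteUniformity A]
variable {S : Type*} [CommRing S] [UniformSpace S] [IsUniformAddGroup S] [IsTopologicalRing S]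
  [IsLinearTopology S S] [T2Space S] [CompleteSpace S] [Algebra A S] [ContinuousSMul A S]
variable (M : NilIdeal S)
variable {𝒪 : Type*} [CommRing 𝒪] (ι : 𝒪 →+* A) (φ : A →+* A) {π₀ : 𝒪} {q : ℕ}
variable {u₀ : 𝒪ˣ} {f f' : PowerSeries 𝒪}
  [IsAdicComplete (Ideal.span {ι π₀}) A] (hA : IsTwistBase (ι π₀) q φ)
  (hφι : ∀ a : 𝒪, φ (ι a) = ι a)
  (hf : IsLTSeries π₀ q f) (hf' : IsLTSeries ((u₀ : 𝒪) * π₀) q f')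
  (h𝒪 : IsLTRing π₀ q) (h𝒪' : IsLTRing ((u₀ : 𝒪) * π₀) q) {ε : A} (hε : φ ε = ι u₀ * ε)

omit [UniformSpace A] [DiscreteUniformity A] [IsAdicComplete (Ideal.span {ι π₀}) A] in
/-- The group law `F_f` read in `A` has no constant term. [cite: LubinTate1965, §1 (4)] -/
theorem constantCoeff_map_ltF (h : IsLTRing π₀ q) (hg : IsLTSeries π₀ q f) :
    (MvPowerSeries.map ι (ltF h hg)).constantCoeff = 0 := by
  rw [MvPowerSeries.constantCoeff_map, constantCoeff_ltF, map_zero]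

include hφι h𝒪 h𝒪' in
/-- **`ϑ(F_f(x, y)) = F_{f'}(ϑ(x), ϑ(y))` on points** of a closed nil ideal `M` (Lubin–Tate (17)
evaluated; de Shalit's `θ` carries the group law of `Ĝ_m` to that of `F_f` on `𝔪`).
[cite: LubinTate1965, Lemma p. 385, (17)] [cite: deShalit1987, I.3.2 (5) (p. 17)] -/
theorem evalPt₁_compSeries_ltAdd (x y : M.toIdeal) :
    evalPt₁ M (compSeries ι φ hA hf hf' hε) (constantCoeff_compSeries ι φ hA hf hf' hε)
        (evalPt M (MvPowerSeries.map ι (ltF h𝒪 hf)) (constantCoeff_map_ltF ι h𝒪 hf) ![x, y]) =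
      evalPt M (MvPowerSeries.map ι (ltF h𝒪' hf')) (constantCoeff_map_ltF ι h𝒪' hf')
        ![evalPt₁ M (compSeries ι φ hA hf hf' hε) (constantCoeff_compSeries ι φ hA hf hf' hε) x,
          evalPt₁ M (compSeries ι φ hA hf hf' hε) (constantCoeff_compSeries ι φ hA hf hf' hε) y] := by
  set ϑ := compSeries ι φ hA hf hf' hε with hϑ
  have hϑ0 : PowerSeries.constantCoeff ϑ = 0 := constantCoeff_compSeries ι φ hA hf hf' hε
  have key := subst_ltF_compSeries ι φ hA hφι hf hf' h𝒪 h𝒪' hε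
  have hG0 := constantCoeff_map_ltF ι h𝒪 hf
  have hG'0 := constantCoeff_map_ltF ι h𝒪' hf'
  -- the substituted family `c = (ϑ(X₀), ϑ(X₁))` and its constant terms
  have hcX : ∀ s : Fin 2, (PowerSeries.subst (MvPowerSeries.X s : MvPowerSeries (Fin 2) A) ϑ).constantCoeff = 0 :=
    fun s ↦ by
      rw [PowerSeries.subst_def]
      exact MvPowerSeries.constantCoeff_subst_eq_zero
        (MvPowerSeries.hasSubst_of_constantCoeff_zero fun _ => MvPowerSeries.constantCoeff_X s)
        (fun _ => MvPowerSeries.constantCoeff_X s) hϑ0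
  have hc0 : ∀ s : Fin 2, ((![PowerSeries.subst (MvPowerSeries.X 0 : MvPowerSeries (Fin 2) A) ϑ,
      PowerSeries.subst (MvPowerSeries.X 1 : MvPowerSeries (Fin 2) A) ϑ]) s).constantCoeff = 0 :=
    fun s ↦ by fin_cases s <;> exact hcX _
  have hL0 : (PowerSeries.subst (MvPowerSeries.map ι (ltF h𝒪 hf)) ϑ).constantCoeff = 0 := by
    rw [PowerSeries.subst_def]
    exact MvPowerSeries.constantCoeff_subst_eq_zero
      (MvPowerSeries.hasSubst_of_constantCoeff_zero fun _ => hG0) (fun _ => hG0) hϑ0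
  have hR0 : (MvPowerSeries.subst ![PowerSeries.subst (MvPowerSeries.X 0 : MvPowerSeries (Fin 2) A) ϑ,
      PowerSeries.subst (MvPowerSeries.X 1 : MvPowerSeries (Fin 2) A) ϑ]
        (MvPowerSeries.map ι (ltF h𝒪' hf'))).constantCoeff = 0 :=
    constantCoeff_subst_zero hc0 hG'0
  -- evaluate both sides of the series identity at `(x, y)`
  have hL := evalPt₁_subst M (MvPowerSeries.map ι (ltF h𝒪 hf)) hG0 ϑ hϑ0 hL0 ![x, y]
  have hR := evalPt_subst M hc0 (MvPowerSeries.map ι (ltF h𝒪' hf')) hG'0 hR0 ![x, y]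
  have e := evalPt_congr M key hL0 hR0 ![x, y]
  rw [hL, hR] at e
  -- identify `ϑ(X_s)` evaluated at `(x, y)` with `ϑ` evaluated at the `s`-th point
  have hs : ∀ s : Fin 2, evalPt M (PowerSeries.subst (MvPowerSeries.X s : MvPowerSeries (Fin 2) A) ϑ)
      (hcX s) ![x, y] = evalPt₁ M ϑ hϑ0 (![x, y] s) := fun s ↦ by
    rw [evalPt₁_subst M (MvPowerSeries.X s : MvPowerSeries (Fin 2) A) (MvPowerSeries.constantCoeff_X s) ϑ hϑ0
      (hcX s) ![x, y], evalPt_X]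
  convert e using 2
  funext s
  fin_cases s
  · exact (hs 0).symm
  · exact (hs 1).symm

include hφι h𝒪 h𝒪' in
/-- **`ϑ([a]_f x) = [a]_{f'}(ϑ x)` on points** (abstract form of `evalPt₁_compSeriesC_homC`; evaluation
of `ϑ ∘ [a]_f = [a]_{f'} ∘ ϑ`, Lubin–Tate (18)); with `a = π₀ⁿ` it carries `[π₀ⁿ]_f`-torsion to
`[π₀ⁿ]_{f'}`-torsion. [cite: LubinTate1965, Lemma p. 385, (18)] [cite: deShalit1987, I.3.2 (5) (p. 17)] -/
theorem evalPt₁_compSeries_hom (a : 𝒪) (x : M.toIdeal)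
    (ha : PowerSeries.constantCoeff ((hom h𝒪 hf hf a).map ι) = 0)
    (ha' : PowerSeries.constantCoeff ((hom h𝒪' hf' hf' a).map ι) = 0) :
    evalPt₁ M (compSeries ι φ hA hf hf' hε) (constantCoeff_compSeries ι φ hA hf hf' hε)
        (evalPt₁ M ((hom h𝒪 hf hf a).map ι) ha x) =
      evalPt₁ M ((hom h𝒪' hf' hf' a).map ι) ha'
        (evalPt₁ M (compSeries ι φ hA hf hf' hε) (constantCoeff_compSeries ι φ hA hf hf' hε) x) := by
  set ϑ := compSeries ι φ hA hf hf' hε with hϑ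
  have hϑ0 : PowerSeries.constantCoeff ϑ = 0 := constantCoeff_compSeries ι φ hA hf hf' hε
  have hser := subst_hom_compSeries ι φ hA hφι hf hf' hε h𝒪 h𝒪' a
  have hc1 : (PowerSeries.subst ((hom h𝒪 hf hf a).map ι) ϑ).constantCoeff = 0 := by
    rw [PowerSeries.subst_def]
    exact MvPowerSeries.constantCoeff_subst_eq_zero
      (MvPowerSeries.hasSubst_of_constantCoeff_zero fun _ => ha) (fun _ => ha) hϑ0
  have hc2 : (PowerSeries.subst ϑ ((hom h𝒪' hf' hf' a).map ι)).constantCoeff = 0 := by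
    rw [PowerSeries.subst_def]
    exact MvPowerSeries.constantCoeff_subst_eq_zero
      (MvPowerSeries.hasSubst_of_constantCoeff_zero fun _ => hϑ0) (fun _ => hϑ0) ha'
  have h1 := evalPt₁_subst M (τ := Unit) (((hom h𝒪 hf hf a).map ι : PowerSeries A) : MvPowerSeries Unit A)
    ha ϑ hϑ0 hc1 (fun _ => x)
  have h2 := evalPt₁_subst M (τ := Unit) (ϑ : MvPowerSeries Unit A) hϑ0 ((hom h𝒪' hf' hf' a).map ι) ha' hc2
    (fun _ => x)
  rw [evalPt_congr M hser hc1 hc2] at h1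
  exact h1.symm.trans h2

include hφι h𝒪 h𝒪' in
/-- **`ϑ` carries `[a]_f`-torsion to `[a]_{f'}`-torsion**: if `[a]_f(x) = 0` then `[a]_{f'}(ϑ(x)) = 0`
(`a = π₀ⁿ`: the level-`n` division points; de Shalit's `ω_n` from `ζ_n − 1`).
[cite: LubinTate1965, Lemma p. 385, (18)] [cite: deShalit1987, I.3.2 (5) (p. 17)] -/
theorem evalPt₁_hom_compSeries_eq_zero (a : 𝒪) (x : M.toIdeal)
    (ha : PowerSeries.constantCoeff ((hom h𝒪 hf hf a).map ι) = 0)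
    (ha' : PowerSeries.constantCoeff ((hom h𝒪' hf' hf' a).map ι) = 0)
    (hx : evalPt₁ M ((hom h𝒪 hf hf a).map ι) ha x = 0) :
    evalPt₁ M ((hom h𝒪' hf' hf' a).map ι) ha'
        (evalPt₁ M (compSeries ι φ hA hf hf' hε) (constantCoeff_compSeries ι φ hA hf hf' hε) x) = 0 := by
  rw [← evalPt₁_compSeries_hom M ι φ hA hφι hf hf' h𝒪 h𝒪' hε a x ha ha', hx, evalPt₁_zero]

end GroupLawPoints

end LubinTate

end Literature.NumberTheory.GaloisRepresentations

end
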